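import Summits.BirchSwinnertonDyer.BirchSwinnertonDyer.Theorems.ResidualThetaTransportAtTwoHeckeThetaPartnerAdicAtTwoUnitCharacterPrelim
import HarnessLib

/-!
# The unit character `λ` of an imaginary quadratic field modulo a rational integer (main theorem)

Route `ResidualThetaTransportAtTwo`, crux K0⁺ `HeckeThetaPartnerAdicAtTwo` (stmt-BirchSwinnertonDyer-20690),
helper §E1′ of the line "proof from print" (input `λ` of `exists_isGrossencharakter_embType`, E1).
THEOREMS ONLY (no definition, no named fact, no `sorry`).

`exists_unitCharacter`: for an imaginary quadratic field `k` with a square root `δ` of a negative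
integer `Δ`, an embedding `σ : k → ℂ` and an integer `t` with `d_k ∣ t`, `|t| ≥ 3`, there is a
character `λ` of `(𝓞 k/(t))ˣ` with `λ(ū) σ(u) = 1` on units and `λ(n̄) = (d_k/n)` (the tree's
`discrChar`) on integers `n` prime to `t`.  Proof: the Kronecker character on the image `P` of the
integers prime to `t`, the character `u ↦ σ(u)⁻¹` on the image `W` of the global units, agree on
`P ∩ W = {±1}` (`unit_sq_eq_one_of_sub_intCast_mem`, `χ_{d_k}(-1) = -1`), and extend jointly to the
whole group (`exists_monoidHom_extension_pair`).
-/

set_option autoImplicit false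
set_option linter.dupNamespace false

noncomputable section

open scoped NumberField ComplexConjugate
open NumberField IsDedekindDomain Module
open Literature.NumberTheory.GaloisRepresentations Literature.NumberTheory.LFunctions
  Literature.NumberTheory.QuadraticFields.Quadratic

namespace Summit.BirchSwinnertonDyer.BirchSwinnertonDyer.Theorems.HeckeThetaPartner


variable {k : Type} [Field k] [NumberField k]

/-- **The unit character.**  `k` imaginary quadratic (`[k:ℚ] = 2`, totally complex) with an
integral `δ`, `δ² = Δ < 0`; `σ : k → ℂ`; `t ∈ ℤ` with `|t| ≥ 3` and `d_k ∣ t`.  Then there is a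
character `λ` of `(𝓞 k/(t))ˣ` with `λ(ū) · σ(u) = 1` for every unit `u` of `𝓞 k` and
`λ(n̄) = χ_{d_k}(n)` (the Kronecker character `discrChar`) for every integer `n` which is a unit
modulo `(t)`. [folklore] -/
theorem exists_unitCharacter (hk : finrank ℚ k = 2) [IsTotallyComplex k] (σ : k →+* ℂ)
    {δ : 𝓞 k} {Δ : ℤ} (hΔ : Δ < 0) (hδ : (δ : k) ^ 2 = (Δ : k)) {t : ℤ} (ht : 3 ≤ |t|)
    (hdt : discr k ∣ t) :
    ∃ lam : (𝓞 k ⧸ Ideal.span {(t : 𝓞 k)})ˣ →* ℂˣ,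
      (∀ u : (𝓞 k)ˣ,
        (lam (Units.map (Ideal.Quotient.mk (Ideal.span {(t : 𝓞 k)})).toMonoidHom u) : ℂ) *
          σ ((u : 𝓞 k) : k) = 1) ∧
      (∀ (n : ℤ) (hn : IsUnit (Ideal.Quotient.mk (Ideal.span {(t : 𝓞 k)}) (n : 𝓞 k))),
        ∃ hu : IsUnit (n : ZMod (discr k).natAbs),
          (lam hn.unit : ℂ) = ((discrChar (discr k) hu.unit : ℤˣ) : ℤ)) := by
  classical
  set I : Ideal (𝓞 k) := Ideal.span {(t : 𝓞 k)} with hI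
  set D : ℤ := discr k with hD
  have hD0 : D ≠ 0 := by rw [hD]; exact_mod_cast discr_ne_zero k
  have hD4 : D % 4 = 0 ∨ D % 4 = 1 := discr_emod_four hk
  have hθ : (δ : k) ∉ Set.range (algebraMap ℚ k) := by
    rintro ⟨r, hr⟩
    have h1 : (algebraMap ℚ k r) ^ 2 = algebraMap ℚ k (Δ : ℚ) := by rw [hr, hδ, map_intCast]
    rw [← map_pow] at h1
    have h2 : r ^ 2 = Δ := by exact_mod_cast (algebraMap ℚ k).injective h1
    nlinarith [sq_nonneg r, h2, (show (Δ : ℚ) < 0 by exact_mod_cast hΔ)]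
  have hDneg : D < 0 := by
    obtain ⟨q, hq0, hq⟩ := NumberField.exists_discr_eq_mul_sq hk hθ (c := (Δ : ℚ)) (by rw [hδ, map_intCast])
    have : (D : ℚ) < 0 := by
      rw [hD, hq]; exact mul_neg_of_neg_of_pos (by exact_mod_cast hΔ) (by positivity)
    exact_mod_cast this
  have ht0 : t ≠ 0 := by rintro rfl; norm_num at ht
  -- an integer which is a unit mod `(t)` is prime to `t`, hence to `D`
  have hcop : ∀ n : ℤ, IsUnit (Ideal.Quotient.mk I (n : 𝓞 k)) → IsUnit (n : ZMod D.natAbs) := by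
    intro n hn
    obtain ⟨w, hw⟩ := hn.exists_right_inv
    obtain ⟨w, rfl⟩ := Ideal.Quotient.mk_surjective w
    rw [← map_mul, ← (Ideal.Quotient.mk I).map_one, Ideal.Quotient.eq, hI, Ideal.mem_span_singleton'] at hw
    obtain ⟨z, hz⟩ := hw
    -- `n w - 1 = z t`; the gcd `g` of `n` and `t` divides `1` in `𝓞 k`, hence in `ℤ`
    set g : ℕ := Int.gcd n t with hg
    have hgn : (g : ℤ) ∣ n := Int.gcd_dvd_left ..
    have hgt : (g : ℤ) ∣ t := Int.gcd_dvd_right ..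
    have hg1 : (g : ℤ) ∣ 1 := by
      refine int_dvd_of_coe_dvd hk ?_
      have h1 : ((1 : ℤ) : 𝓞 k) = (n : 𝓞 k) * w - z * (t : 𝓞 k) := by push_cast; linear_combination hz
      rw [h1]
      exact dvd_sub (Dvd.dvd.mul_right (Int.cast_dvd_cast _ _ hgn) _)
        (Dvd.dvd.mul_left (Int.cast_dvd_cast _ _ hgt) _)
    have hcopt : IsCoprime n t := by
      rw [Int.isCoprime_iff_gcd_eq_one]
      have := Int.eq_one_of_dvd_one (Int.natCast_nonneg _) hg1
      exact_mod_cast this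
    have hcopD : IsCoprime n D := hcopt.of_isCoprime_of_dvd_right hdt
    obtain ⟨a, b, hab⟩ := hcopD
    have hD' : (D : ZMod D.natAbs) = 0 := by
      rw [ZMod.intCast_zmod_eq_zero_iff_dvd]
      exact Int.natAbs_dvd.mpr dvd_rfl
    refine isUnit_iff_exists_inv.mpr ⟨(a : ZMod D.natAbs), ?_⟩
    have := congrArg (fun x : ℤ => (x : ZMod D.natAbs)) hab
    push_cast at this
    rw [hD', mul_zero, add_zero] at this
    rw [mul_comm]; exact this
  -- an integer which is a unit mod `(t)` is prime to `t`
  have hcopt : ∀ n : ℤ, IsUnit (Ideal.Quotient.mk I (n : 𝓞 k)) → IsCoprime n t := by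
    intro n hn
    obtain ⟨hu⟩ := (⟨hcop n hn⟩ : Nonempty _)
    -- redo the gcd argument (cheaper: from `hcop` we only kept coprimality with `D`)
    obtain ⟨w, hw⟩ := hn.exists_right_inv
    obtain ⟨w, rfl⟩ := Ideal.Quotient.mk_surjective w
    rw [← map_mul, ← (Ideal.Quotient.mk I).map_one, Ideal.Quotient.eq, hI, Ideal.mem_span_singleton'] at hw
    obtain ⟨z, hz⟩ := hw
    set g : ℕ := Int.gcd n t with hg
    have hg1 : (g : ℤ) ∣ 1 := by
      refine int_dvd_of_coe_dvd hk ?_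
      have h1 : ((1 : ℤ) : 𝓞 k) = (n : 𝓞 k) * w - z * (t : 𝓞 k) := by push_cast; linear_combination hz
      rw [h1]
      exact dvd_sub (Dvd.dvd.mul_right (Int.cast_dvd_cast _ _ (Int.gcd_dvd_left ..)) _)
        (Dvd.dvd.mul_left (Int.cast_dvd_cast _ _ (Int.gcd_dvd_right ..)) _)
    rw [Int.isCoprime_iff_gcd_eq_one]
    have := Int.eq_one_of_dvd_one (Int.natCast_nonneg _) hg1
    exact_mod_cast this
  -- congruent integers mod `(t)` have the same Kronecker symbol
  have hDper : ∀ a b : ℤ, (a : 𝓞 k) - b ∈ I → (a : ZMod D.natAbs) = b := by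
    intro a b hab
    rw [hI, Ideal.mem_span_singleton] at hab
    have h1 : t ∣ a - b := int_dvd_of_coe_dvd hk (by push_cast; exact hab)
    have h2 : D ∣ a - b := hdt.trans h1
    rw [ZMod.intCast_eq_intCast_iff_dvd_sub]
    exact Int.natAbs_dvd.mpr ((dvd_sub_comm.mp h2))
  /- the monoid `S` of integers invertible mod `(t)`, its image `P` in `G = (𝓞 k/(t))ˣ` and the
  Kronecker character on it -/
  let S : Submonoid ℤ :=
    { carrier := {n | IsUnit (Ideal.Quotient.mk I (n : 𝓞 k))}
      mul_mem' := by
        intro a b ha hb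
        simp only [Set.mem_setOf_eq, Int.cast_mul, map_mul] at ha hb ⊢
        exact ha.mul hb
      one_mem' := by simp }
  have hS : ∀ n : S, IsUnit (Ideal.Quotient.mk I ((n : ℤ) : 𝓞 k)) := fun n => n.2
  let dZ : S →* (𝓞 k ⧸ I)ˣ :=
    { toFun := fun n => (hS n).unit
      map_one' := Units.ext (by simp)
      map_mul' := fun a b => Units.ext (by
        simp only [IsUnit.unit_spec, Units.val_mul, Submonoid.coe_mul, Int.cast_mul, map_mul]) }
  let φZ : S →* ℂˣ :=
    { toFun := fun n => Units.map (Int.castRingHom ℂ).toMonoidHom (discrChar D (hcop n (hS n)).unit)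
      map_one' := by
        have : (hcop (1 : S) (hS 1)).unit = 1 := Units.ext (by simp)
        rw [this, map_one, map_one]
      map_mul' := fun a b => by
        have : (hcop (a * b : S) (hS (a * b))).unit = (hcop a (hS a)).unit * (hcop b (hS b)).unit :=
          Units.ext (by simp)
        rw [this, map_mul, map_mul] }
  have hfib : ∀ a b : S, dZ a = dZ b → φZ a = φZ b := by
    intro a b hab
    have h1 : Ideal.Quotient.mk I ((a : ℤ) : 𝓞 k) = Ideal.Quotient.mk I ((b : ℤ) : 𝓞 k) := by
      have := congrArg Units.val hab
      simpa [dZ] using this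
    have h2 : ((a : ℤ) : ZMod D.natAbs) = (b : ℤ) := hDper _ _ (Ideal.Quotient.eq.mp h1)
    have h3 : (hcop a (hS a)).unit = (hcop b (hS b)).unit := Units.ext (by simpa using h2)
    simp only [φZ, MonoidHom.coe_mk, OneHom.coe_mk, h3]
  obtain ⟨ΛZ, hΛZ⟩ := exists_monoidHom_comp_eq complexUnits_exists_pow_eq dZ φZ hfib
  -- the subgroup `P = dZ(S)` (closed under inverses: invert `n` mod `t`)
  let P : Subgroup (𝓞 k ⧸ I)ˣ :=
    { carrier := {g | ∃ n : S, dZ n = g}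
      mul_mem' := by
        rintro _ _ ⟨a, rfl⟩ ⟨b, rfl⟩
        exact ⟨a * b, map_mul dZ a b⟩
      one_mem' := ⟨1, map_one dZ⟩
      inv_mem' := by
        rintro _ ⟨a, rfl⟩
        obtain ⟨x, y, hxy⟩ := hcopt a (hS a)
        have hx : IsUnit (Ideal.Quotient.mk I (x : 𝓞 k)) := by
          refine isUnit_iff_exists_inv.mpr ⟨Ideal.Quotient.mk I (a : 𝓞 k), ?_⟩
          rw [← map_mul, ← (Ideal.Quotient.mk I).map_one, Ideal.Quotient.eq, hI, Ideal.mem_span_singleton']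
          exact ⟨-(y : 𝓞 k), by
            have := congrArg (fun z : ℤ => (z : 𝓞 k)) hxy
            push_cast at this ⊢
            linear_combination -this⟩
        refine ⟨⟨x, hx⟩, ?_⟩
        rw [eq_inv_iff_mul_eq_one]
        apply Units.ext
        rw [Units.val_mul, Units.val_one]
        change Ideal.Quotient.mk I ((x : ℤ) : 𝓞 k) * Ideal.Quotient.mk I ((a : ℤ) : 𝓞 k) = 1
        rw [← map_mul, ← (Ideal.Quotient.mk I).map_one, Ideal.Quotient.eq, hI, Ideal.mem_span_singleton']
        exact ⟨-(y : 𝓞 k), by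
          have := congrArg (fun z : ℤ => (z : 𝓞 k)) hxy
          push_cast at this ⊢
          linear_combination -this⟩ }
  -- the units of `𝓞 k` inside `G` and the character `u ↦ σ(u)⁻¹`
  let qU : (𝓞 k)ˣ →* (𝓞 k ⧸ I)ˣ := Units.map (Ideal.Quotient.mk I).toMonoidHom
  have hqU : Function.Injective qU := by
    intro u v huv
    have h1 : Ideal.Quotient.mk I ((u : 𝓞 k)) = Ideal.Quotient.mk I (v : 𝓞 k) := by
      have := congrArg Units.val huv
      simpa [qU, Units.coe_map] using this
    have hmem : ((u * v⁻¹ : (𝓞 k)ˣ) : 𝓞 k) - 1 ∈ I := by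
      rw [← Ideal.Quotient.eq, Units.val_mul, map_mul, h1, ← map_mul, Units.mul_inv, map_one]
    have := unit_eq_one_of_sub_one_mem hk σ ht hmem
    rwa [mul_inv_eq_one] at this
  let W : Subgroup (𝓞 k ⧸ I)ˣ := qU.range
  let eU : (𝓞 k)ˣ ≃* W := MonoidHom.ofInjective hqU
  have hσ0 : ∀ u : (𝓞 k)ˣ, σ ((u : 𝓞 k) : k) ≠ 0 := fun u => by
    rw [map_ne_zero]; exact_mod_cast u.ne_zero
  let ψU : (𝓞 k)ˣ →* ℂˣ :=
    { toFun := fun u => (Units.mk0 _ (hσ0 u))⁻¹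
      map_one' := Units.ext (by simp)
      map_mul' := fun a b => by
        rw [← mul_inv]
        congr 1
        exact Units.ext (by simp) }
  let φW : W →* ℂˣ := ψU.comp eU.symm.toMonoidHom
  have hφW : ∀ u : (𝓞 k)ˣ, φW ⟨qU u, ⟨u, rfl⟩⟩ = ψU u := by
    intro u
    change ψU (eU.symm ⟨qU u, ⟨u, rfl⟩⟩) = ψU u
    congr 1
    exact eU.injective (by rw [MulEquiv.apply_symm_apply]; rfl)
  -- compatibility on `W ∩ P`: a unit congruent to an integer is `±1`
  have hcompat : ∀ (w : W) (hp : (w : (𝓞 k ⧸ I)ˣ) ∈ P), φW w = ΛZ.restrict P ⟨w, hp⟩ := by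
    rintro ⟨_, ⟨u, rfl⟩⟩ ⟨n, hn⟩
    rw [MonoidHom.restrict_apply]
    change φW ⟨qU u, ⟨u, rfl⟩⟩ = ΛZ (qU u)
    have hn' : dZ n = qU u := hn
    rw [hφW, ← hn', hΛZ]
    -- `u ≡ n mod I`
    have hun : ((u : 𝓞 k)) - (n : ℤ) ∈ I := by
      rw [← Ideal.Quotient.eq]
      have := congrArg Units.val hn
      simpa [dZ, qU] using this.symm
    rcases unit_sq_eq_one_of_sub_intCast_mem hk σ hΔ hδ ht hun with rfl | rfl
    · -- `u = 1`, `n ≡ 1`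
      have h1 : ((n : ℤ) : ZMod D.natAbs) = 1 := by
        have := hDper n 1 (by simpa using I.neg_mem hun)
        simpa using this
      have h2 : (hcop n (hS n)).unit = 1 := Units.ext (by simpa using h1)
      apply Units.ext
      simp [φZ, ψU, h2]
    · -- `u = -1`, `n ≡ -1`
      have h1 : ((n : ℤ) : ZMod D.natAbs) = -1 := by
        have := hDper n (-1) (by simpa [sub_eq_add_neg, add_comm] using I.neg_mem hun)
        simpa using this
      have h2 : (hcop n (hS n)).unit = -1 := Units.ext (by simpa using h1)
      apply Units.ext
      simp [φZ, ψU, h2, discrChar_neg_one hDneg hD4]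
  obtain ⟨Λ, hΛP, hΛW⟩ := exists_monoidHom_extension_pair P W (ΛZ.restrict P) φW
    (fun w hp => (hcompat w hp))
  refine ⟨Λ, fun u => ?_, fun n hn => ⟨hcop n hn, ?_⟩⟩
  · have := hΛW ⟨qU u, ⟨u, rfl⟩⟩
    rw [hφW] at this
    change (Λ (qU u) : ℂ) * _ = 1
    rw [this]
    simp [ψU]
  · have hP : (hn.unit : (𝓞 k ⧸ I)ˣ) ∈ P := ⟨⟨n, hn⟩, rfl⟩
    have := hΛP ⟨hn.unit, hP⟩
    rw [MonoidHom.restrict_apply] at this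
    change Λ hn.unit = ΛZ hn.unit at this
    rw [this, show hn.unit = dZ ⟨n, hn⟩ from rfl, hΛZ]
    simp [φZ]

end Summit.BirchSwinnertonDyer.BirchSwinnertonDyer.Theorems.HeckeThetaPartner

end
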